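import Summits.ResolutionOfSingularities.ResolutionOfSingularities.Theorems.PurelyInseparableDim4SwapTransportWindowPlaySigma
import Summits.ResolutionOfSingularities.ResolutionOfSingularities.Theorems.PurelyInseparableDim4SwapTransportWindowResidualPrime
import HarnessLib
import HarnessLib.Audit.Tags

/-!
# Purely inseparable four-folds — THE VIRTUAL WINDOW FROM A SATELLITE ENTRY, FOR EVERY σ = (n, n) + 0: the class-(iii) two-slot
# power-cone killer with rotations MODULO THE ENTRY (cell `res-dim4-pi`, K2(p) lane, B-LF (iii-b) class (iii), virtual port 1 ↦ n of the
# C∞ window, FILE R1 = W6a `…SwapTransportWindowResidualPrime` p717850 with `1 ↦ n`)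

[OURS · counted 0 · cell `res-dim4-pi` · K2(p) lane (holder res-dim4-p-12 g5, rulings g5-21 (α) / g5-23) · seat res-dim4-typ-1 g6.]
Nothing here proves K2(p) for any `p`, any TAIL(p, d, 3), `NoIsolatedTrap p p` or resolution of singularities in dimension ≥ 4 /
characteristic `p` — NOT proved.  AI kernel work, weaker than expert review.  The class-(iii) sub-row «two-slot power-cone tail σ = (n, n) + 0
with rotations» is here reduced to ONE hypothesis `hE` (the ENTRY: beyond every index some real time carries a framed virtual partner — with dead
ROW and FLAG — for every precision and jet; the entry is res-dim4-p-3's side and is NOT in this file).  HONEST STATUS OF THE ENTRY (ruling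
g5-23): the row flag AS WORDED is refuted on real chains (res-dim4-eng-w4 QFLAG-1: 778 / 3,790 flagless in-regime nodes, persistent flagless
branch VTU-2); so `hE` as worded is NOT dischargeable on every chain — it covers the FLAGGED branch (flag-existence is an exact invariant of pure
slot steps, QFLAG-1b), and the flagless branch needs the reshaped frame (FLAGLESS-1 / FLAGLESS♯ / QFLAG-2).  This file is transport bookkeeping
and is correct as a conditional statement either way.

* §1 **`virtual_window_false_at_sigma0`** — an entry at a real time `k` whose step re-creates the slot `π₀ λ` (slot step in the chart `π₀ λ`,
  or rotation translating `π₀ λ` away) and whose NEXT step is SATELLITE (`FreeTail.IsSatellite j b k`) feeds B1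
  `virtual_window_false_of_entry_sigma0` (`ℓs 0 = λ`, `ℓs 1 = μ` are read off the recursion rule; the recursion data and the common
  certificate are W6a's `exists_virtual_data_prime` / `exists_common_cert_prime`, any exponent); window `T ≥ 4(d − 1) + 2`.
* §2 **`cInf_no_chain_of_entry_sigma0`** — an isolated above-floor `Step0 p` chain with `x^{r₀} ∣ F₀`, shade `d` (`n + d = p`, `0 < n`,
  `2 ≤ d`), `e_G = 3` and weights of total degree `2n` from `k₀`, witnessed with rotations ALLOWED, is impossible MODULO THE ENTRY `hE`:
  free-tail lemma (`FreeTailProof.noIsolatedFreeTailAt_self (p)`) for a satellite time `s ≥ k`, I1 `virtual_iterate_sigma0` to `s`,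
  `virtual_window_false_at_sigma0` at `s` (naming `λ ↔ μ` by which slot the step at `s` re-creates, G1 `step_cases_of_weights_sigma0`).
DICTIONARY against W6a: order `d + 2 ↦ p + n`, weights `≤ 1` of degree `2 ↦` degree `2n` (with the entry's `n·π₀λ + n·π₀μ`), ledger
`2 ≤ ↦ n + 1 ≤`, budgets `Nc + 2p + 2 ↦ Nc + 2p + n + 1`, `d + 4 ↦ p + n + 2`.
[cite: Hauser2010, §§F–G] [cite: CossartJannsenSaito2020, Thm. 3.14]
bears_on: LADDER-RESOLUTION:D157-DOOR2 (res-dim4-pi · K2(p) · power cones · class (iii) virtual window residual ∀ p ∀ n).  Supports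
stmt-ResolutionOfSingularities-16155 (helper).
-/

set_option linter.dupNamespace false -- mandated namespace of this single-conjunct summit

noncomputable section

namespace Summit.ResolutionOfSingularities.ResolutionOfSingularities.Theorems.PIDim4

namespace SwapTransport

open MvPolynomial Finset
open Literature.AlgebraicGeometry.Resolution
open Literature.AlgebraicGeometry.Resolution.CentreBlowup
open Literature.AlgebraicGeometry.Resolution.Hauser2010
open Literature.AlgebraicGeometry.Resolution.HauserPerlega2019

variable {K : Type} [Field K] [DecidableEq K]

/-! ## §1 The window from a satellite entry, every prime, every σ = (n, n) + 0 -/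

/-- **THE VIRTUAL WINDOW FROM A SATELLITE ENTRY, every prime, every σ = (n, n) + 0** (module docstring §1). [OURS]
[cite: Hauser2010, §§F–G] [cite: CossartJannsenSaito2020, Thm. 3.14] -/
theorem virtual_window_false_at_sigma0 (p : ℕ) [Fact p.Prime] [CharP K p] {n d : ℕ} (hσ : n + d = p) (hn : 0 < n) (hd2 : 2 ≤ d)
    {eu ef : ℕ} (hef : eu + ef = d - 2) {la mu u f : Fin 4} (hlm : la ≠ mu) (hlu : la ≠ u) (hlf : la ≠ f) (hmu : mu ≠ u) (hmf : mu ≠ f)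
    (huf : u ≠ f) {c : ℕ → State K} {j : ℕ → Fin 4} {b : ℕ → Fin 4 → K} (hw : FreeTail.IsWitnessedChain p c j b) {k Nc T : ℕ}
    (hT : 4 * (d - 1) + 2 ≤ T) (hisoR : ∀ t, t ≤ T + 1 → IsIsolated p (c (k + t)).F)
    (hcert : ∀ t, t ≤ T + 1 → originIdeal K ^ Nc ≤ singLocusIdeal p (c (k + t)).F ⊔ originIdeal K ^ (Nc + 1))
    (hoR : ∀ t, t ≤ T + 1 → ordZero (c (k + t)).F = ((p + n : ℕ) : ℕ∞))
    (he3R : ∀ t, t ≤ T + 1 → Module.finrank K (ResCone.resVertex (c (k + t))) = 3)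
    (hwtR : ∀ t, t ≤ T + 1 → (c (k + t)).r.degree = 2 * n)
    (hdivR : ∀ t, t ≤ T + 1 → ∀ e ∈ (c (k + t)).F.support, (c (k + t)).r ≤ e)
    {π₀ : Equiv.Perm (Fin 4)} {B₀ : State K} {M N : ℕ} (hM : Nc + 2 * p + n + 1 + p * (T + 1) ≤ M)
    (hN : p + n + 2 + d * (T + 1) ≤ N)
    (hrel0 : ∃ (θ e : Fin 4 → MvPolynomial (Fin 4) K) (U E : MvPolynomial (Fin 4) K),
      θ (π₀ la) = X la * e la ∧ θ (π₀ mu) = X mu * e mu ∧ constantCoeff (e la) ≠ 0 ∧ constantCoeff (e mu) ≠ 0 ∧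
      constantCoeff (θ (π₀ u)) = 0 ∧ constantCoeff (θ (π₀ f)) = 0 ∧
      coeff (Finsupp.single u 1) (θ (π₀ u)) * coeff (Finsupp.single f 1) (θ (π₀ f)) -
        coeff (Finsupp.single f 1) (θ (π₀ u)) * coeff (Finsupp.single u 1) (θ (π₀ f)) ≠ 0 ∧
      constantCoeff U ≠ 0 ∧ E ∈ originIdeal K ^ M ∧ B₀.F = deletePthPowers p (U ^ p * aeval θ (c k).F) + E)
    (hrA0 : (c k).r = Finsupp.single (π₀ la) n + Finsupp.single (π₀ mu) n)
    (hfr0 : ordZero B₀.F = ((p + n : ℕ) : ℕ∞) ∧ B₀.r = Finsupp.single la n + Finsupp.single mu n ∧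
      (∀ e ∈ B₀.F.support, B₀.r ≤ e) ∧ (∃ a : K, a ≠ 0 ∧ ResCone.resForm B₀ = C a * X f ^ d) ∧
      (∀ e ∈ B₀.F.support, e f ≤ d - 1 → n + 1 ≤ e la ∧ n + 1 ≤ e mu) ∧
      (∀ e ∈ B₀.F.support, e.degree < N → ¬ (e u = eu ∧ e f = ef)) ∧
      coeff (B₀.r + (Finsupp.single la 1 + Finsupp.single mu 1 + Finsupp.single u (eu + 1) + Finsupp.single f ef)) B₀.F ≠ 0 ∧
      IsIsolated p B₀.F ∧ Module.finrank K (ResCone.resVertex B₀) = 3)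
    (hstart : j k = π₀ la ∨ (j k ≠ π₀ la ∧ j k ≠ π₀ mu ∧ b k (π₀ la) ≠ 0)) (hsat : FreeTail.IsSatellite j b k) :
    False := by
  obtain ⟨πs, Bs, ℓs, hπ0, hB0, hBs, hℓs, hπs⟩ := exists_virtual_data_prime p j b k la mu π₀ B₀
  subst hπ0 hB0
  have hπlm : πs 0 la ≠ πs 0 mu := fun h => hlm ((πs 0).injective h)
  -- the first virtual chart is `λ`, and `πs 1 λ` is the newest real letter `j k`
  have hx0 : ℓs 0 = la := by
    rw [hℓs 0, Nat.add_zero]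
    rcases hstart with h | ⟨h1, h2, h3⟩
    · rw [if_pos h]
    · rw [if_neg h1, if_neg h2, if_pos h3]
  have hπ1 : πs 1 la = j k := by
    rw [hπs 0, Nat.add_zero]
    rcases hstart with h | ⟨h1, h2, -⟩
    · rw [if_pos (Or.inl h), h]
    · rw [if_neg (not_or.mpr ⟨h1, h2⟩), hx0, Equiv.trans_apply, Equiv.swap_apply_left, Equiv.apply_symm_apply]
  -- the satellite step `k + 1` charts the other slot: `ℓs 1 = μ`
  have hx1 : ℓs 1 = mu := by
    obtain ⟨hne, hb0⟩ := hsat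
    rw [hℓs 1, hπ1, if_neg hne]
    by_cases h : j (k + 1) = πs 1 mu
    · rw [if_pos h]
    · rw [if_neg h, if_neg (not_not.mpr hb0)]
  exact virtual_window_false_of_entry_sigma0 p hσ hn hd2 hef hlm hlu hlf hmu hmf huf hw hT hisoR hcert hoR he3R hwtR hdivR hBs hℓs
    hπs hM hN hrel0 hrA0 hfr0 hx0 hx1

/-! ## §2 The class-(iii) two-slot killer with rotations, modulo the entry, every prime, every σ = (n, n) + 0 -/

/-- **THE CLASS-(iii) TWO-SLOT POWER-CONE CONFIGURATION σ = (n, n) + 0 WITH ROTATIONS IS IMPOSSIBLE — MODULO THE ENTRY `hE`, every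
prime** (module docstring §2): an isolated above-floor `Step0 p` chain with `x^{r₀} ∣ F₀`, shade `d` (`n + d = p`, `0 < n`, `2 ≤ d`) and
`e_G = 3` from `k₀`, weights of total degree `2n`, witnessed (rotations allowed), gives `False` once, beyond every index, some time `k`
carries a framed virtual partner of `c k` along some `π₀` (real weights `n·π₀λ + n·π₀μ`) for every precision `M` and jet `N`.  Route:
satellite time `s ≥ k` (free-tail lemma `FreeTailProof.noIsolatedFreeTailAt_self (p)`), I1 `virtual_iterate_sigma0` from `k` to `s`, then
`virtual_window_false_at_sigma0` at `s` (naming `λ ↔ μ` by which slot the step at `s` re-creates, G1 `step_cases_of_weights_sigma0`). [OURS]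
[cite: Hauser2010, §§F–G] [cite: CossartJannsenSaito2020, Thm. 3.14] -/
theorem cInf_no_chain_of_entry_sigma0 (p : ℕ) [Fact p.Prime] [CharP K p] {n d : ℕ} (hσ : n + d = p) (hn : 0 < n) (hd2 : 2 ≤ d)
    {c : ℕ → State K} {j : ℕ → Fin 4} {b : ℕ → Fin 4 → K}
    (hc : ∀ k, IsIsolated p (c k).F ∧ Step0 p (c k) (c (k + 1))) (hw : FreeTail.IsWitnessedChain p c j b)
    (hr0 : ∀ e ∈ (c 0).F.support, (c 0).r ≤ e) (hfloor : ∀ k, ordZero (c k).F ≠ (p : ℕ)) {k₀ : ℕ}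
    (hshade : ∀ k, k₀ ≤ k → (c k).shade = ((d : ℕ) : ℕ∞))
    (he3 : ∀ k, k₀ ≤ k → Module.finrank K (ResCone.resVertex (c k)) = 3)
    (hwt : ∀ k, k₀ ≤ k → (c k).r.degree = 2 * n)
    (hE : ∀ k₂, ∃ k, k₂ ≤ k ∧ ∃ (la mu u f : Fin 4) (π₀ : Equiv.Perm (Fin 4)) (eu ef : ℕ),
      la ≠ mu ∧ la ≠ u ∧ la ≠ f ∧ mu ≠ u ∧ mu ≠ f ∧ u ≠ f ∧ eu + ef = d - 2 ∧
      (c k).r = Finsupp.single (π₀ la) n + Finsupp.single (π₀ mu) n ∧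
      ∀ M N : ℕ, ∃ B₀ : State K,
        (∃ (θ e : Fin 4 → MvPolynomial (Fin 4) K) (U E : MvPolynomial (Fin 4) K),
          θ (π₀ la) = X la * e la ∧ θ (π₀ mu) = X mu * e mu ∧ constantCoeff (e la) ≠ 0 ∧ constantCoeff (e mu) ≠ 0 ∧
          constantCoeff (θ (π₀ u)) = 0 ∧ constantCoeff (θ (π₀ f)) = 0 ∧
          coeff (Finsupp.single u 1) (θ (π₀ u)) * coeff (Finsupp.single f 1) (θ (π₀ f)) -
            coeff (Finsupp.single f 1) (θ (π₀ u)) * coeff (Finsupp.single u 1) (θ (π₀ f)) ≠ 0 ∧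
          constantCoeff U ≠ 0 ∧ E ∈ originIdeal K ^ M ∧ B₀.F = deletePthPowers p (U ^ p * aeval θ (c k).F) + E) ∧
        ordZero B₀.F = ((p + n : ℕ) : ℕ∞) ∧ B₀.r = Finsupp.single la n + Finsupp.single mu n ∧
        (∀ e ∈ B₀.F.support, B₀.r ≤ e) ∧ (∃ a : K, a ≠ 0 ∧ ResCone.resForm B₀ = C a * X f ^ d) ∧
        (∀ e ∈ B₀.F.support, e f ≤ d - 1 → n + 1 ≤ e la ∧ n + 1 ≤ e mu) ∧
        (∀ e ∈ B₀.F.support, e.degree < N → ¬ (e u = eu ∧ e f = ef)) ∧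
        coeff (B₀.r + (Finsupp.single la 1 + Finsupp.single mu 1 + Finsupp.single u (eu + 1) + Finsupp.single f ef)) B₀.F ≠ 0 ∧
        IsIsolated p B₀.F ∧ Module.finrank K (ResCone.resVertex B₀) = 3) : False := by
  obtain ⟨k, hk, la, mu, u, f, π₀, eu, ef, hlm, hlu, hlf, hmu, hmf, huf, hef, hrA0, hB⟩ := hE k₀
  -- the window length of the game
  set Tw : ℕ := 4 * (d - 1) + 2 with hTw
  -- global regime facts
  have hiso : ∀ k, IsIsolated p (c k).F := fun k => (hc k).1
  have ho6 : ∀ m, k₀ ≤ m → ordZero (c m).F = ((p + n : ℕ) : ℕ∞) := fun m hm => by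
    obtain ⟨o, ho, -, -, hod⟩ := ResCone.chain_shade_nat p hc hfloor hshade hm
    rw [hwt m hm] at hod
    have h6 : o = p + n := by omega
    rw [ho, h6]
  have hdiv : ∀ m, ∀ e ∈ (c m).F.support, (c m).r ≤ e := IsolatedBand.isolated_chain_forall_le hc hr0
  -- a satellite time `s = k + T`
  obtain ⟨s, hks, hsat⟩ := (FreeTail.satelliteRecurrenceAt_iff_noIsolatedFreeTailAt p p).mpr
    (FreeTailProof.noIsolatedFreeTailAt_self p) K c j b hw hiso k
  obtain ⟨T, rfl⟩ : ∃ T, s = k + T := ⟨s - k, by omega⟩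
  -- a common certificate on `c k, …, c (k + T + Tw + 1)`, the budgets, the entry and the virtual data
  obtain ⟨Nc, hcert⟩ := exists_common_cert_prime p (T := T + (Tw + 1)) (fun t _ => hiso (k + t))
  obtain ⟨B₀, hrel0, hfr0⟩ := hB (Nc + 2 * p + n + 1 + p * (Tw + 1) + p * T) (p + n + 2 + d * (Tw + 1) + d * T)
  obtain ⟨πs, Bs, ℓs, hπ0, hB0, hBs, hℓs, hπs⟩ := exists_virtual_data_prime p j b k la mu π₀ B₀
  subst hπ0 hB0
  -- phase 1: iterate to the satellite time
  obtain ⟨hrelT, hrAT, hfrT⟩ := virtual_iterate_sigma0 p hσ hn hd2 hef hlm hlu hlf hmu hmf huf hw (T := T) (fun t _ => hiso (k + t))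
    (fun t ht => hcert t (by omega)) (fun t _ => ho6 (k + t) (by omega)) (fun t _ => he3 (k + t) (by omega))
    (fun t _ => hwt (k + t) (by omega)) (fun t _ => hdiv (k + t)) hBs hℓs hπs (by omega) (by omega) hrel0 hrA0 hfr0 T
    le_rfl
  -- phase 2 inputs at the base `k + T`
  have hcertW : ∀ t, t ≤ Tw + 1 → originIdeal K ^ Nc ≤ singLocusIdeal p (c (k + T + t)).F ⊔ originIdeal K ^ (Nc + 1) :=
    fun t ht => by rw [Nat.add_assoc]; exact hcert (T + t) (by omega)
  have hisoW : ∀ t, t ≤ Tw + 1 → IsIsolated p (c (k + T + t)).F := fun t _ => hiso _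
  have hoW : ∀ t, t ≤ Tw + 1 → ordZero (c (k + T + t)).F = ((p + n : ℕ) : ℕ∞) := fun t _ => ho6 _ (by omega)
  have he3W : ∀ t, t ≤ Tw + 1 → Module.finrank K (ResCone.resVertex (c (k + T + t))) = 3 := fun t _ => he3 _ (by omega)
  have hwtW : ∀ t, t ≤ Tw + 1 → (c (k + T + t)).r.degree = 2 * n := fun t _ => hwt _ (by omega)
  have hdivW : ∀ t, t ≤ Tw + 1 → ∀ e ∈ (c (k + T + t)).F.support, (c (k + T + t)).r ≤ e := fun t _ => hdiv _
  have hM : Nc + 2 * p + n + 1 + p * (Tw + 1) ≤ Nc + 2 * p + n + 1 + p * (Tw + 1) + p * T - p * T := by omega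
  have hN : p + n + 2 + d * (Tw + 1) ≤ p + n + 2 + d * (Tw + 1) + d * T - d * T := by omega
  -- the swapped-orientation copies
  obtain ⟨θ, e, U, E, h1, h2, h3, h4, h5, h6, h7, h8, h9, h10⟩ := hrelT
  obtain ⟨hoT, hrT, hdivT, hformT, hledT, hrowT, hVT, hisoT, he3T⟩ := hfrT
  have hrelS : ∃ (θ e : Fin 4 → MvPolynomial (Fin 4) K) (U E : MvPolynomial (Fin 4) K),
      θ (πs T mu) = X mu * e mu ∧ θ (πs T la) = X la * e la ∧ constantCoeff (e mu) ≠ 0 ∧ constantCoeff (e la) ≠ 0 ∧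
      constantCoeff (θ (πs T u)) = 0 ∧ constantCoeff (θ (πs T f)) = 0 ∧
      coeff (Finsupp.single u 1) (θ (πs T u)) * coeff (Finsupp.single f 1) (θ (πs T f)) -
        coeff (Finsupp.single f 1) (θ (πs T u)) * coeff (Finsupp.single u 1) (θ (πs T f)) ≠ 0 ∧
      constantCoeff U ≠ 0 ∧ E ∈ originIdeal K ^ (Nc + 2 * p + n + 1 + p * (Tw + 1) + p * T - p * T) ∧
      (Bs T).F = deletePthPowers p (U ^ p * aeval θ (c (k + T)).F) + E :=
    ⟨θ, e, U, E, h2, h1, h4, h3, h5, h6, h7, h8, h9, h10⟩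
  have hrAS : (c (k + T)).r = Finsupp.single (πs T mu) n + Finsupp.single (πs T la) n := by rw [hrAT, add_comm]
  have hfrS : ordZero (Bs T).F = ((p + n : ℕ) : ℕ∞) ∧ (Bs T).r = Finsupp.single mu n + Finsupp.single la n ∧
      (∀ e ∈ (Bs T).F.support, (Bs T).r ≤ e) ∧ (∃ a : K, a ≠ 0 ∧ ResCone.resForm (Bs T) = C a * X f ^ d) ∧
      (∀ e ∈ (Bs T).F.support, e f ≤ d - 1 → n + 1 ≤ e mu ∧ n + 1 ≤ e la) ∧
      (∀ e ∈ (Bs T).F.support, e.degree < p + n + 2 + d * (Tw + 1) + d * T - d * T → ¬ (e u = eu ∧ e f = ef)) ∧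
      coeff ((Bs T).r + (Finsupp.single mu 1 + Finsupp.single la 1 + Finsupp.single u (eu + 1) + Finsupp.single f ef)) (Bs T).F ≠ 0 ∧
      IsIsolated p (Bs T).F ∧ Module.finrank K (ResCone.resVertex (Bs T)) = 3 := by
    refine ⟨hoT, by rw [hrT, add_comm], hdivT, hformT, fun e he hf => (hledT e he hf).symm, hrowT, ?_, hisoT, he3T⟩
    rw [add_comm (Finsupp.single mu 1) (Finsupp.single la 1)]; exact hVT
  -- which slot does the step at `k + T` re-create?
  have hπlm : πs T la ≠ πs T mu := fun h => hlm ((πs T).injective h)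
  have hπlu : πs T la ≠ πs T u := fun h => hlu ((πs T).injective h)
  have hπlf : πs T la ≠ πs T f := fun h => hlf ((πs T).injective h)
  have hπmu : πs T mu ≠ πs T u := fun h => hmu ((πs T).injective h)
  have hπmf : πs T mu ≠ πs T f := fun h => hmf ((πs T).injective h)
  have hπuf : πs T u ≠ πs T f := fun h => huf ((πs T).injective h)
  obtain ⟨-, -, -, -, hcs⟩ := hw (k + T)
  have hdeg' : (CentreBlowup.step p Finset.univ (j (k + T)) (b (k + T)) (c (k + T))).r.degree = 2 * n := by
    rw [← hcs]; exact hwt (k + T + 1) (by omega)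
  rcases step_cases_of_weights_sigma0 p hn hπlm hπlu hπlf hπmu hπmf hπuf hrAT (ho6 (k + T) (by omega)) hdeg' with
    ⟨hjr, -, -⟩ | ⟨hjr, -, -⟩ | ⟨hjr, hrot⟩
  · exact virtual_window_false_at_sigma0 p hσ hn hd2 hef hlm hlu hlf hmu hmf huf hw le_rfl hisoW hcertW hoW he3W hwtW hdivW hM hN
      ⟨θ, e, U, E, h1, h2, h3, h4, h5, h6, h7, h8, h9, h10⟩ hrAT ⟨hoT, hrT, hdivT, hformT, hledT, hrowT, hVT, hisoT, he3T⟩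
      (Or.inl hjr) hsat
  · exact virtual_window_false_at_sigma0 p hσ hn hd2 hef hlm.symm hmu hmf hlu hlf huf hw le_rfl hisoW hcertW hoW he3W hwtW hdivW
      hM hN hrelS hrAS hfrS (Or.inl hjr) hsat
  · have hjl : j (k + T) ≠ πs T la := by rcases hjr with h | h <;> rw [h] <;> [exact hπlu.symm; exact hπlf.symm]
    have hjm : j (k + T) ≠ πs T mu := by rcases hjr with h | h <;> rw [h] <;> [exact hπmu.symm; exact hπmf.symm]
    rcases hrot with ⟨hbla, -, -⟩ | ⟨hbmu, -, -⟩
    · exact virtual_window_false_at_sigma0 p hσ hn hd2 hef hlm hlu hlf hmu hmf huf hw le_rfl hisoW hcertW hoW he3W hwtW hdivW hM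
        hN ⟨θ, e, U, E, h1, h2, h3, h4, h5, h6, h7, h8, h9, h10⟩ hrAT ⟨hoT, hrT, hdivT, hformT, hledT, hrowT, hVT, hisoT, he3T⟩
        (Or.inr ⟨hjl, hjm, hbla⟩) hsat
    · exact virtual_window_false_at_sigma0 p hσ hn hd2 hef hlm.symm hmu hmf hlu hlf huf hw le_rfl hisoW hcertW hoW he3W hwtW
        hdivW hM hN hrelS hrAS hfrS (Or.inr ⟨hjm, hjl, hbmu⟩) hsat

end SwapTransport

end Summit.ResolutionOfSingularities.ResolutionOfSingularities.Theorems.PIDim4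

end
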